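import Literature.AnabelianGeometry.SemiGraphs.MetabelianLeafStarTreeWalk
import Literature.AnabelianGeometry.SemiGraphs.MetabelianLeafStarAdaptedLevel
import Literature.AnabelianGeometry.SemiGraphs.MetabelianLeafStarElevated
import Literature.AnabelianGeometry.SemiGraphs.TemperedCompactInVerticialAt
import Literature.AnabelianGeometry.SemiGraphs.TemperedPiVerticialLevelData
import HarnessLib

/-!
# [SemiAnbd] Thm 3.7 (iii), ∀-countable typing, FAILS at the RAYLESS star `𝒢⋆(p)` («RAYLESS-STAR·CIV-NEG», S6)

Mochizuki, *Semi-graphs of anabelioids*, Publ. RIMS **42** (2006), Theorem 3.7 (iii) pp. 40–41 (for a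
FINITE semi-graph: "any compact subgroup of `π₁^temp(𝒢)` is contained in a verticial subgroup"); the cell's
∀-countable typing is `CompactInVerticialAt` / the named fact `CompactInVerticial` ([IUTchI] Rmk 2.5.3 (ii):
countable semi-graphs) [cite: MochizukiSemiAnbd2006, Thm 3.7(iii) pp.40-41].

PROOF-ONLY file (abc-iut cell, layer L3, row «RAYLESS-STAR·CIV-NEG», seat abc-iut-L3-t8 gen 6; desk memo
HOME/staging/L3/L3-t8/g6/VERTICAL-ESCAPE-RAYLESS-STAR-L3t8g6.md; release-note class **misstated-as-∀,
NEW CARRIER CLASS (rayless)**: the ∀-countable closure of Thm 3.7 (iii) was already refuted at the RAY `𝒢_θ`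
(abc-iut-L3-d4, `ThetaRayRefutation.not_compactInVerticial`); here it fails at a countable semi-graph with NO
ray — the star `𝒢⋆(p)` of infinite valence with rayless universal covering — so «locally finite» /
«no infinite ray» repairs of the typing do not rescue it either).

**`metabelianLeafStar_not_compactInVerticialAt : ¬ CompactInVerticialAt (metabelianLeafStar p)`** (the
∀-closure `¬ CompactInVerticial` being already in the tree via the ray `𝒢_θ`, `ThetaRayRefutation.lean`).  The
compact procyclic subgroup `⟨c⟩‾`, `c = lim_k (m_0⋯m_k)·ψ₀(a)·(m_0⋯m_k)⁻¹` (`MetabelianLeafStarEscapeElement.lean`),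
lies in no verticial subgroup of the canonical chart:
* not over a LEAF `n`: the twisted abelian character `Φ^{(n)}` kills every verticial subgroup over the leaf
  `n` but `Φ^{(n)}(c) = Φ^{(n)}(a) = −pⁿ ≠ 0`;
* not over the CENTRE: if `c ∈ ψ_P(Π_centre)` with `P = g·P₀`, then at a deep level the element `c` fixes the
  tree path from `(h_k·P₀).vertex` to `(g·P₀).vertex`, which therefore carries no branch over `(n, true)`
  (`edgeMap_edgeOf_ne_of_ne_one`), so the translation character `ψ̄_n` takes the same value on `h_k` and `g`
  (`chi_eq_of_walk`), namely `1 (mod p)` — for EVERY `n`; but at ONE level adapted to all the `ψ̄_n`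
  (`exists_level_adaptedTo_leafStarPsi`) the tree path from `P₀.vertex` to `(g·P₀).vertex` meets only finitely
  many leaf types, and for any other `n` the same walk lemma gives `ψ̄_n(g) = ψ̄_n(1) = 0`.
The hypotheses of Thm 3.7 at `𝒢⋆(p)` are theorems (`metabelianLeafStar_thm37Hypotheses'`), so the refutation is
unconditional.  Print's Thm 3.7 (iii) (finite `𝔾`) is untouched; no side is taken on [IUTchIII] Cor 3.12.
-/

noncomputable section

open CategoryTheory Topology Multiplicative

namespace Literature.AnabelianGeometry.SemiGraphs

open IwahoriWitness

namespace ProfiniteSemiGraph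

variable {p : ℕ} [hp : Fact p.Prime] {h36 : (metabelianLeafStar p).Prop36Hypotheses}
  (P₀ : ((metabelianLeafStar p).galoisLevelData h36).PointSeq h36.isCountable (leafStarCentre p))

/-! ### Small helpers -/

/-- The level kernels decrease: `ρ_N g = 1 ⇒ ρ_j g = 1` for `j ≤ N`. [cite: MochizukiSemiAnbd2006, Prop 3.6(i) p.38] -/
theorem proj_eq_one_of_le {j N : ℕ} (hjN : j ≤ N)
    (g : ((metabelianLeafStar p).galoisLevelData h36).temperedPi h36.isCountable)
    (hg : ((metabelianLeafStar p).galoisLevelData h36).proj h36.isCountable N g = 1) :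
    ((metabelianLeafStar p).galoisLevelData h36).proj h36.isCountable j g = 1 := by
  rw [← ((metabelianLeafStar p).galoisLevelData h36).mapLE_proj h36.isCountable hjN g, hg, map_one]

/-- `Φ^{(n)}` kills the leaf `n`: `(pⁿ − pⁿ)·log = 0`. [cite: MochizukiSemiAnbd2006, Thm 3.7(iii) p.41] -/
theorem leafStarPhiV_leaf_self (n : ℕ) (x : Iw.Leaf (p := p) n) : leafStarPhiV p n (leafStarLeaf p n) x = 1 := by
  change Iw.logChar n (n + 1) _ x = 1
  rw [Iw.logChar_apply, sub_self, zero_mul, ofAdd_zero]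

/-- `Φ^{(n)}` kills the conjugates of the branch image of the edge `n` at the centre.
[cite: MochizukiSemiAnbd2006, Thm 3.7(iii) p.41] -/
theorem linChar_conj_θα (n : ℕ) (f : FreeProPRankTwo.Grp p) (k : Multiplicative ℤ_[p]) :
    FreeProPRankTwo.linChar p (n + 1) (-((p : ZMod (p ^ (n + 1))) ^ n)) 1
      (f * FreeProPRankTwo.θα p n k * f⁻¹) = 1 := by
  rw [map_mul, map_mul, map_inv, FreeProPRankTwo.linChar_θα, one_mul, neg_add_cancel, zero_mul, ofAdd_zero, mul_one,
    mul_inv_cancel]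

/-- The torsor character in the currency of the canonical tower `D` (abc-iut-L3-t8's
`exists_character_of_characters`, retyped). [cite: MochizukiSemiAnbd2006, Prop 3.6(ii) p.38] -/
theorem exists_character_D (h36 : (metabelianLeafStar p).Prop36Hypotheses) {A : Type} [CommGroup A]
    [TopologicalSpace A] [DiscreteTopology A] [Finite A]
    (χV : ∀ v : (metabelianLeafStar p).graph.Vertex, (metabelianLeafStar p).Gv v →ₜ* A)
    (χE : ∀ e : (metabelianLeafStar p).graph.Edge, (metabelianLeafStar p).Ge e →ₜ* A)
    (hχ : ∀ (b : (metabelianLeafStar p).graph.Branch) (v : (metabelianLeafStar p).graph.Vertex)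
      (h : (metabelianLeafStar p).graph.abuts b = some v) (t : (metabelianLeafStar p).Ge ((metabelianLeafStar p).graph.edgeOf b)),
      χV v ((metabelianLeafStar p).brHom b v h t) = χE ((metabelianLeafStar p).graph.edgeOf b) t) :
    ∃ χ : ((metabelianLeafStar p).galoisLevelData h36).temperedPi h36.isCountable →* A,
      (∀ (v : (metabelianLeafStar p).graph.Vertex)
        (P : ((metabelianLeafStar p).galoisLevelData h36).PointSeq h36.isCountable v) (h : (metabelianLeafStar p).Gv v),
        χ (P.decompHom h) = χV v h) ∧
      (∀ j : ℕ, CovObj.AdaptedTo χV χE (((metabelianLeafStar p).galoisLevelData h36).S j) →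
        ∀ g, ((metabelianLeafStar p).galoisLevelData h36).proj h36.isCountable j g = 1 → χ g = 1) ∧
      ∃ j₁ : ℕ, ∀ g, ((metabelianLeafStar p).galoisLevelData h36).proj h36.isCountable j₁ g = 1 → χ g = 1 :=
  exists_character_of_characters χV χE h36 hχ

/-- A character's value on `h_k = m_0 ⋯ m_k` when it sees only `m_n` (value `t`): `t` once `k ≥ n`, else `1`.
[cite: MochizukiSemiAnbd2006, Thm 3.7(iii) p.41] -/
theorem chi_escH {A : Type*} [CommGroup A]
    (χ : ((metabelianLeafStar p).galoisLevelData h36).temperedPi h36.isCountable →* A) (n : ℕ) (t : A)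
    (hχ : ∀ i, χ (escM P₀ i) = if i = n then t else 1) (k : ℕ) :
    χ (escH P₀ k) = if n ≤ k then t else 1 := by
  induction k with
  | zero =>
    change χ (escM P₀ 0) = _
    rw [hχ 0]
    by_cases h : n = 0
    · subst h; simp
    · rw [if_neg (Ne.symm h), if_neg (by omega)]
  | succ k ih =>
    rw [escH_succ, map_mul, ih, hχ (k + 1)]
    by_cases h1 : n ≤ k
    · rw [if_pos h1, if_neg (by omega), if_pos (by omega), mul_one]
    · by_cases h2 : k + 1 = n
      · rw [if_neg h1, if_pos h2, if_pos (by omega), one_mul]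
      · rw [if_neg h1, if_neg h2, if_neg (by omega), one_mul]

/-- The action of `c_k` at level `N` fixes the vertex `(h_k·P₀).vertex N` (`c_k = ψ_{h_k·P₀}(a)`).
[cite: MochizukiSemiAnbd2006, Thm 3.7(iii) p.41] -/
theorem treeAct_escC_vertexMap (k N : ℕ) :
    (((metabelianLeafStar p).galoisLevelData h36).treeAct h36.isCountable N (escC P₀ k)).hom.vertexMap
        ((P₀.smul (escH P₀ k)).vertex N) = (P₀.smul (escH P₀ k)).vertex N := by
  have h : escC P₀ k = (P₀.smul (escH P₀ k)).decompHom (FreeProPRankTwo.a p) := by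
    rw [GaloisLevelData.PointSeq.decompHom_smul]; rfl
  rw [h]
  exact (P₀.smul (escH P₀ k)).treeAct_decompHom_vertexMap N _

/-! ### The refutation -/

variable (p)

/-- **[SemiAnbd] Thm 3.7 (iii), first clause, in its ∀-countable typing, FAILS at the rayless star `𝒢⋆(p)`**:
the compact procyclic subgroup `⟨c⟩‾ ≤ π₁^temp(𝒢⋆(p))` (canonical chart) lies in NO verticial subgroup.
Release-note class: misstated-as-∀, NEW CARRIER CLASS (rayless, infinite valence).
[cite: MochizukiSemiAnbd2006, Thm 3.7(iii) pp.40-41] -/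
theorem metabelianLeafStar_not_compactInVerticialAt : ¬ CompactInVerticialAt (metabelianLeafStar p) := by
  classical
  intro hCIV
  haveI : NeZero p := ⟨hp.out.ne_zero⟩
  have h37 : (metabelianLeafStar p).Thm37Hypotheses := metabelianLeafStar_thm37Hypotheses' p
  have h36 : (metabelianLeafStar p).Prop36Hypotheses := h37.toProp36Hypotheses
  obtain ⟨P₀⟩ := GaloisLevelData.nonempty_pointSeq h36 (leafStarCentre p)
  obtain ⟨c, N, hcN, hC, hact⟩ := exists_escapeLimit P₀
  have hcC : c ∈ (Subgroup.zpowers c).topologicalClosure :=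
    Subgroup.le_topologicalClosure _ (Subgroup.mem_zpowers c)
  -- the typing applied to the canonical chart and `⟨c⟩‾`
  obtain ⟨⟨v, H, hH, hCH⟩, -⟩ := hCIV h37 ((metabelianLeafStar p).temperedPiChart h36)
    ((Subgroup.zpowers c).topologicalClosure) hC
  obtain ⟨ψ, hψ, rfl⟩ := hH
  obtain ⟨P, hP⟩ := exists_pointSeq_of_isVerticialHom (h36 := h36) (v := v) (ψ := ψ) hψ
  obtain ⟨f, hf⟩ := hCH hcC
  have hcP : P.decompHom f = c := by rw [hP]; exact hf
  -- characters read `c` through `y = ψ₀(a)`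
  have hread : ∀ {A : Type} [CommGroup A]
      (χ : ((metabelianLeafStar p).galoisLevelData h36).temperedPi h36.isCountable →* A) (j : ℕ),
      (∀ g, ((metabelianLeafStar p).galoisLevelData h36).proj h36.isCountable j g = 1 → χ g = 1) → χ c = χ (psi0 P₀ (FreeProPRankTwo.a p)) := by
    intro A _ χ j hker
    have h1 : χ (c * (escC P₀ (N j))⁻¹) = 1 := hker _ (by rw [map_mul, map_inv, hcN j (N j) le_rfl, mul_inv_cancel])
    rw [map_mul, map_inv, mul_inv_eq_one] at h1
    rw [h1, escC, map_mul, map_mul, map_inv, mul_inv_cancel_comm]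
    rfl
  cases v with
  | some n =>
    -- LEAF `n`: the twisted abelian character `Φ^{(n)}` kills `ψ_P(Leaf n) ∋ c`, but `Φ^{(n)}(c) = Φ^{(n)}(a) ≠ 1`
    obtain ⟨Φ, hΦP, -, j₂, hj₂⟩ := exists_character_D h36 (leafStarPhiV p n) (leafStarPhiE p n)
      (leafStarPhi_compatible p n)
    have h1 : Φ c = 1 := by rw [← hcP, hΦP]; exact leafStarPhiV_leaf_self n f
    have h2 : Φ c ≠ 1 := by
      rw [hread Φ j₂ hj₂, show Φ (psi0 P₀ (FreeProPRankTwo.a p)) =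
        leafStarPhiV p n (leafStarCentre p) (FreeProPRankTwo.a p) from hΦP (leafStarCentre p) P₀ _]
      exact leafStarPhiV_centre_a_ne_one p n
    exact h2 h1
  | none =>
    -- CENTRE: `P = g·P₀`, so `c` fixes `(g·P₀).vertex M` at every level `M`
    obtain ⟨g, rfl⟩ := P₀.exists_smul_eq P
    have hfixg : ∀ M, (((metabelianLeafStar p).galoisLevelData h36).treeAct h36.isCountable M c).hom.vertexMap ((P₀.smul g).vertex M) =
        (P₀.smul g).vertex M := fun M => by
      rw [← hcP]; exact (P₀.smul g).treeAct_decompHom_vertexMap M f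
    -- for every `n`: the translation character `ψ̄_n` (mod `p`) takes the value `1 (mod p)` on `g`
    have key : ∀ (n : ℕ) (χ : ((metabelianLeafStar p).galoisLevelData h36).temperedPi h36.isCountable →* Multiplicative (ZMod (p ^ 1))),
        (∀ (w : (metabelianLeafStar p).graph.Vertex) (Q : ((metabelianLeafStar p).galoisLevelData h36).PointSeq h36.isCountable w)
          (h : (metabelianLeafStar p).Gv w),
          χ (Q.decompHom h) = leafStarPsiV p n 1 (Nat.succ_le_succ (Nat.zero_le n)) w h) →
        (∃ j₁ : ℕ, ∀ g', ((metabelianLeafStar p).galoisLevelData h36).proj h36.isCountable j₁ g' = 1 → χ g' = 1) → χ g = ofAdd 1 := by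
      intro n χ hχP hχj
      obtain ⟨j₁, hj₁⟩ := hχj
      obtain ⟨Φ, hΦP, -, j₂, hj₂⟩ := exists_character_D h36 (leafStarPhiV p n) (leafStarPhiE p n)
        (leafStarPhi_compatible p n)
      have hχleaf : ∀ (m : ℕ) (l : Iw.Leaf (p := p) m),
          χ (psiLeaf P₀ m l) = leafStarPsiV p n 1 (Nat.succ_le_succ (Nat.zero_le n)) (leafStarLeaf p m) l :=
        fun m l => hχP (leafStarLeaf p m) (leafSeq P₀ m) l
      have hΦ0 : ∀ f' : FreeProPRankTwo.Grp p, Φ (psi0 P₀ f') = leafStarPhiV p n (leafStarCentre p) f' :=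
        fun f' => hΦP (leafStarCentre p) P₀ f'
      -- the level and the index
      have hkerχ : ∀ g', ((metabelianLeafStar p).galoisLevelData h36).proj h36.isCountable (max j₁ j₂) g' = 1 → χ g' = 1 :=
        fun g' hg' => hj₁ g' (proj_eq_one_of_le (le_max_left _ _) g' hg')
      have hkerΦ : ∀ g', ((metabelianLeafStar p).galoisLevelData h36).proj h36.isCountable (max j₁ j₂) g' = 1 → Φ g' = 1 :=
        fun g' hg' => hj₂ g' (proj_eq_one_of_le (le_max_right _ _) g' hg')
      have h0 : ∀ f' : FreeProPRankTwo.Grp p, χ (psi0 P₀ f') = 1 := fun f' => hχP _ P₀ f'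
      have hleaf : ∀ m, m ≠ n → ∀ l : Iw.Leaf (p := p) m, χ (psiLeaf P₀ m l) = 1 := by
        intro m hm l
        rw [hχleaf]
        exact leafStarPsiV_leaf_ne p n 1 _ hm l
      have hΦc : Φ c ≠ 1 := by
        rw [hread Φ j₂ hj₂, hΦ0]
        exact leafStarPhiV_centre_a_ne_one p n
      have hΦbr : ∀ (f' : FreeProPRankTwo.Grp p) (t : Multiplicative ℤ_[p]),
          Φ (psi0 P₀ (f' * FreeProPRankTwo.θα p n t * f'⁻¹)) = 1 := by
        intro f' t
        rw [hΦ0]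
        exact linChar_conj_θα n f' t
      -- `c` acts at level `M := max j₁ j₂` like `c_k`, `k := max (N M) n`; both ends of the path are `c`-fixed
      have hfix1 : (((metabelianLeafStar p).galoisLevelData h36).treeAct h36.isCountable (max j₁ j₂) c).hom.vertexMap
          ((P₀.smul (escH P₀ (max (N (max j₁ j₂)) n))).vertex (max j₁ j₂)) =
          (P₀.smul (escH P₀ (max (N (max j₁ j₂)) n))).vertex (max j₁ j₂) := by
        rw [hact (max j₁ j₂) _ (le_max_left _ _)]; exact treeAct_escC_vertexMap P₀ _ _
      have hfix2 := hfixg (max j₁ j₂)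
      -- the fixed path
      have hT := (((metabelianLeafStar p).galoisLevelData h36).isTree_tree (max j₁ j₂)).isTree
      obtain ⟨w⟩ := hT.connected (Sum.inl ((P₀.smul (escH P₀ (max (N (max j₁ j₂)) n))).vertex (max j₁ j₂)) :
        (((metabelianLeafStar p).galoisLevelData h36).tree (max j₁ j₂)).Node) (Sum.inl ((P₀.smul g).vertex (max j₁ j₂)))
      have hnode : ∀ z ∈ w.bypass.support, SemiGraph.nodeMap (((metabelianLeafStar p).galoisLevelData h36).treeAct h36.isCountable (max j₁ j₂) c) z = z :=
        SemiGraph.nodeMap_eq_self_of_isPath hT.isAcyclic _ (by simp [hfix1]) (by simp [hfix2]) w.bypass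
          w.bypass_isPath
      have havoid : ∀ (a : ((metabelianLeafStar p).galoisLevelData h36).temperedPi h36.isCountable) (β : (((metabelianLeafStar p).galoisLevelData h36).tree (max j₁ j₂)).Branch),
          (((metabelianLeafStar p).galoisLevelData h36).tree (max j₁ j₂)).abuts β = some ((P₀.smul a).vertex (max j₁ j₂)) →
          (Sum.inr (Sum.inr β) : (((metabelianLeafStar p).galoisLevelData h36).tree (max j₁ j₂)).Node) ∈ w.bypass.support →
          (((metabelianLeafStar p).galoisLevelData h36).treeProj (max j₁ j₂)).branchMap β ≠ ((n, true) : ℕ × Bool) := by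
        intro a β hβ hmem hβb
        have hfixβ := hnode _ hmem
        rw [SemiGraph.nodeMap_inr_inr, Sum.inr.injEq, Sum.inr.injEq] at hfixβ
        have hedge : (((metabelianLeafStar p).galoisLevelData h36).treeAct h36.isCountable (max j₁ j₂) c).hom.edgeMap ((((metabelianLeafStar p).galoisLevelData h36).tree (max j₁ j₂)).edgeOf β) =
            (((metabelianLeafStar p).galoisLevelData h36).tree (max j₁ j₂)).edgeOf β := by
          rw [← (((metabelianLeafStar p).galoisLevelData h36).treeAct h36.isCountable (max j₁ j₂) c).hom.edgeOf_branchMap β, hfixβ]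
        exact edgeMap_edgeOf_ne_of_ne_one P₀ Φ (max j₁ j₂) n hkerΦ hΦbr c hΦc a β hβb hβ hedge
      have hwalk := chi_eq_of_walk P₀ χ (max j₁ j₂) hkerχ h0 n hleaf (escH P₀ (max (N (max j₁ j₂)) n)) g
        w.bypass w.bypass_isPath havoid
      -- `χ(h_k) = 1 (mod p)` since `k ≥ n`
      have hχM : ∀ i, χ (escM P₀ i) = if i = n then ofAdd 1 else 1 := by
        intro i
        rw [escM, hχleaf]
        by_cases hi : i = n
        · subst hi; rw [if_pos rfl]; exact leafStarPsiV_translLeaf p i 1 _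
        · rw [if_neg hi]; exact leafStarPsiV_leaf_ne p n 1 _ hi _
      rw [← hwalk, chi_escH P₀ χ n (ofAdd 1) hχM, if_pos (le_max_right _ _)]
    -- ONE level adapted to all `ψ̄_n`; the path from `P₀.vertex` to `(g·P₀).vertex` there meets finitely many types
    obtain ⟨i₁, hi₁⟩ := exists_level_adaptedTo_leafStarPsi p h36
    have hT := (((metabelianLeafStar p).galoisLevelData h36).isTree_tree i₁).isTree
    obtain ⟨w⟩ := hT.connected (Sum.inl ((P₀.smul 1).vertex i₁) : (((metabelianLeafStar p).galoisLevelData h36).tree i₁).Node)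
      (Sum.inl ((P₀.smul g).vertex i₁))
    -- the finitely many leaf types read at the branch nodes of the path
    let types : Finset ℕ := (w.bypass.support.filterMap fun z =>
      match z with
      | Sum.inr (Sum.inr β) => some ((((metabelianLeafStar p).galoisLevelData h36).treeProj i₁).branchMap β).1
      | _ => none).toFinset
    obtain ⟨n, hn⟩ := Infinite.exists_notMem_finset types
    have havoid : ∀ (a : ((metabelianLeafStar p).galoisLevelData h36).temperedPi h36.isCountable) (β : (((metabelianLeafStar p).galoisLevelData h36).tree i₁).Branch),
        (((metabelianLeafStar p).galoisLevelData h36).tree i₁).abuts β = some ((P₀.smul a).vertex i₁) →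
        (Sum.inr (Sum.inr β) : (((metabelianLeafStar p).galoisLevelData h36).tree i₁).Node) ∈ w.bypass.support →
        (((metabelianLeafStar p).galoisLevelData h36).treeProj i₁).branchMap β ≠ ((n, true) : ℕ × Bool) := by
      intro a β _ hmem hβb
      apply hn
      rw [List.mem_toFinset, List.mem_filterMap]
      exact ⟨Sum.inr (Sum.inr β), hmem, by simp only [hβb]⟩
    -- the character `ψ̄_n`, adapted at `i₁`
    obtain ⟨χ, hχP, hχadapt, hχj⟩ := exists_character_D h36
      (leafStarPsiV p n 1 (Nat.succ_le_succ (Nat.zero_le n))) (leafStarPsiE p 1) (leafStarPsi_compatible p n 1 _)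
    have hker : ∀ g', ((metabelianLeafStar p).galoisLevelData h36).proj h36.isCountable i₁ g' = 1 → χ g' = 1 := hχadapt i₁ (hi₁ i₁ le_rfl n)
    have h0 : ∀ f' : FreeProPRankTwo.Grp p, χ (psi0 P₀ f') = 1 := fun f' => hχP _ P₀ f'
    have hleaf : ∀ m, m ≠ n → ∀ l : Iw.Leaf (p := p) m, χ (psiLeaf P₀ m l) = 1 := by
      intro m hm l
      exact (hχP (leafStarLeaf p m) (leafSeq P₀ m) l).trans (leafStarPsiV_leaf_ne p n 1 _ hm l)
    have hwalk := chi_eq_of_walk P₀ χ i₁ hker h0 n hleaf 1 g w.bypass w.bypass_isPath havoid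
    rw [map_one, key n χ hχP hχj] at hwalk
    -- `1 = ofAdd 1` in `ℤ/p`: absurd
    have h01 : (1 : ZMod (p ^ 1)) = 0 := by
      have := congrArg Multiplicative.toAdd hwalk
      rwa [toAdd_one, toAdd_ofAdd, eq_comm] at this
    haveI : Fact (1 < p ^ 1) := ⟨by rw [pow_one]; exact hp.out.one_lt⟩
    exact one_ne_zero h01

/- Remark.  The ∀-closure `¬ CompactInVerticial.{0}` is already a theorem of the tree (abc-iut-L3-d4,
`ThetaRayRefutation.not_compactInVerticial`, carrier: the RAY `𝒢_θ`); the present file adds a second, RAYLESS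
carrier — `metabelianLeafStar_not_compactInVerticialAt 2 (compactInVerticial_iff_forall_at.mp h _)` re-derives it. -/

end ProfiniteSemiGraph

end Literature.AnabelianGeometry.SemiGraphs

end
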